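import Mathlib.MeasureTheory.Integral.Bochner.Basic
import Mathlib.MeasureTheory.Integral.Bochner.ContinuousLinearMap
import Mathlib.MeasureTheory.Integral.IntegrableOn
import Mathlib.Algebra.Order.Chebyshev
import HarnessLib

/-!
# The Kazakov–Zheng convex relaxation block read at finite `N`: `⟨m mᵀ, [[1, Wᵀ], [W, Q]]⟩ ≥ −E(Σ m_A Im t_A)²` (gauge-boot, large-`N` supplement 1)

HONEST FRAMING (cell `pub-gaugeboot`, page 1 of every file): the venture produces certified bounds
on lattice expectations at stated coupling, gauge group, dimension and torus size; NOT a mass gap,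
NOT a continuum limit, NOT a string tension; NOT large `N` unless marked CONDITIONAL; NOT
Yang–Mills-summit-bearing (barriers `FixedCouplingUltralocality`, `PerturbativeInvisibility`).
Pure algebra / probability; this file certifies no number and names no lattice.

## What this is

The planar (`N = ∞`) lattice bootstrap of Kazakov–Zheng (arXiv:2203.11360, §3.2) closes the
Makeenko–Migdal loop equations on single-trace Wilson loops `W = (W_A)` by large-`N` factorisation
and replaces the products `W_A W_B` appearing in them by new variables `Q_{AB}`, relaxing
`Q = W Wᵀ` to the positive semi-definiteness of the block `[[1, Wᵀ], [W, Q]]`.  A dual certificate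
of that SDP pairs this block with a positive semi-definite multiplier; written as a sum of rank-one
terms `m mᵀ`, `m = (m₀, (m_A)_A)`, one term contributes

`shorPairing m₀ m W Q = m₀² + 2 m₀ Σ_A m_A W_A + Σ_{A,B} m_A m_B Q_{AB}`.

At `N = ∞` (`Q = W Wᵀ`) this is the square `(m₀ + Σ m_A W_A)²` (`shorPairing_factorised`).  At
FINITE `N` the loop equations hold exactly (for `U(N)`; up to explicit terms for `SU(N)`) when the
product `W_A W_B` is read as the PAIR EXPECTATION `Re E[t_A t_B]` of the normalised traces
`t_A = tr ρ(hol A)/N` (the tree's `LoopEquationPairForm` / `ZdLoopEquationStates`).  With that reading,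
for ANY complex random variables `t_A` on a probability space,

`shorPairing m₀ m (Re E t) (Re E[t t]) = E(m₀ + Σ m_A Re t_A)² − E(Σ m_A Im t_A)²`
(`shorPairing_integral_eq`), hence `≥ −E(Σ_A m_A Im t_A)²` (`shorPairing_integral_ge`) and
`≥ −(#ι) Σ_A m_A² E(Im t_A)²` (`shorPairing_integral_ge_card`): the relaxation block is violated at
finite `N` by at most the second moments of the IMAGINARY PARTS of the loop variables entering it —
the quantities large-`N` factorisation sends to zero.  Also the linear-functional form for the
word-truncated bootstrap (`shorPairing_apply_eq`, `shorPairing_apply_ge`: any linear `φ` that is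
non-negative on squares).

References: Kazakov–Zheng arXiv:2203.11360 §3.2 (the relaxation); Kazakov–Zheng arXiv:2108.04830
(relaxation for matrix models); Anderson–Kruczenski Nucl. Phys. B 921 (2017) §2 (finite-`N` loop
equations with expectations of products of traces).  The finite-`N` reading is [folklore] algebra.
-/

noncomputable section

open MeasureTheory
open scoped BigOperators

namespace Summit.QuantumFields.GaugeBoot

variable {ι : Type*} [Fintype ι]

/-! ## The pairing of the relaxation block with a rank-one multiplier -/

/-- **Kazakov–Zheng's relaxation block paired with a rank-one multiplier** `m mᵀ`,
`m = (m₀, (m_A)_A)`: `⟨m mᵀ, [[1, Wᵀ], [W, Q]]⟩ = m₀² + 2 m₀ Σ_A m_A W_A + Σ_{A,B} m_A m_B Q_{AB}`.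
[cite: KazakovZheng2023, §3.2] -/
def shorPairing (m₀ : ℝ) (m : ι → ℝ) (W : ι → ℝ) (Q : ι → ι → ℝ) : ℝ :=
  m₀ ^ 2 + 2 * m₀ * ∑ A, m A * W A + ∑ A, ∑ B, m A * m B * Q A B

/-- The double sum of a rank-one kernel is the square of the single sum. [folklore] -/
theorem sum_sum_mul_mul_eq_sq (a : ι → ℝ) : ∑ A, ∑ B, a A * a B = (∑ A, a A) ^ 2 := by
  rw [sq, Finset.sum_mul_sum]

/-- **At `N = ∞` the pairing is a square**: with factorised pair variables `Q = W Wᵀ`,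
`shorPairing m₀ m W (W Wᵀ) = (m₀ + Σ_A m_A W_A)²`. [folklore] -/
theorem shorPairing_factorised (m₀ : ℝ) (m W : ι → ℝ) :
    shorPairing m₀ m W (fun A B => W A * W B) = (m₀ + ∑ A, m A * W A) ^ 2 := by
  have h : ∑ A, ∑ B, m A * m B * (W A * W B) = (∑ A, m A * W A) ^ 2 := by
    rw [← sum_sum_mul_mul_eq_sq]
    exact Finset.sum_congr rfl fun A _ => Finset.sum_congr rfl fun B _ => by ring
  rw [shorPairing, h]
  ring

/-- **Feasibility of the relaxation** `[[1, Wᵀ], [W, Q]] ⪰ 0`, in factor form: every rank-one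
pairing is non-negative (equivalent to positive semi-definiteness of the block; we only use this
direction). [cite: KazakovZheng2023, §3.2] -/
def IsRelaxationFeasible (W : ι → ℝ) (Q : ι → ι → ℝ) : Prop :=
  ∀ (m₀ : ℝ) (m : ι → ℝ), 0 ≤ shorPairing m₀ m W Q

/-- Factorised (planar) data is feasible for the relaxation. [folklore] -/
theorem isRelaxationFeasible_factorised (W : ι → ℝ) : IsRelaxationFeasible W fun A B => W A * W B :=
  fun m₀ m => by rw [shorPairing_factorised]; exact sq_nonneg _

/-- The pairing is affine in the data: linearity in `(W, Q)` at fixed constant part. [folklore] -/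
theorem shorPairing_eq_sum (m₀ : ℝ) (m : ι → ℝ) (W : ι → ℝ) (Q : ι → ι → ℝ) :
    shorPairing m₀ m W Q = m₀ ^ 2 + ∑ A, (2 * m₀ * m A) * W A + ∑ A, ∑ B, (m A * m B) * Q A B := by
  simp only [shorPairing, Finset.mul_sum]
  congr 1
  · congr 1
    exact Finset.sum_congr rfl fun A _ => by ring

/-! ## The pointwise complex reading: `Q_{AB} = Re(t_A t_B)` -/

/-- **The finite-`N` reading, pointwise**: for complex numbers `t_A` (the normalised traces of one
configuration), with `W_A = Re t_A` and `Q_{AB} = Re(t_A t_B)`,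
`shorPairing m₀ m W Q = (m₀ + Σ m_A Re t_A)² − (Σ m_A Im t_A)²` — `Re(z²) = (Re z)² − (Im z)²` for
`z = m₀ + Σ m_A t_A`. [folklore] -/
theorem shorPairing_re_eq (m₀ : ℝ) (m : ι → ℝ) (t : ι → ℂ) :
    shorPairing m₀ m (fun A => (t A).re) (fun A B => (t A * t B).re) =
      (m₀ + ∑ A, m A * (t A).re) ^ 2 - (∑ A, m A * (t A).im) ^ 2 := by
  have h : ∑ A, ∑ B, m A * m B * (t A * t B).re =
      (∑ A, m A * (t A).re) ^ 2 - (∑ A, m A * (t A).im) ^ 2 := by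
    rw [← sum_sum_mul_mul_eq_sq, ← sum_sum_mul_mul_eq_sq, ← Finset.sum_sub_distrib]
    refine Finset.sum_congr rfl fun A _ => ?_
    rw [← Finset.sum_sub_distrib]
    refine Finset.sum_congr rfl fun B _ => ?_
    rw [Complex.mul_re]
    ring
  rw [shorPairing, h]
  ring

/-- Hence, pointwise, the pairing is at least `−(Σ_A m_A Im t_A)²`. [folklore] -/
theorem shorPairing_re_ge (m₀ : ℝ) (m : ι → ℝ) (t : ι → ℂ) :
    -((∑ A, m A * (t A).im) ^ 2) ≤ shorPairing m₀ m (fun A => (t A).re) (fun A B => (t A * t B).re) := by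
  rw [shorPairing_re_eq]
  linarith [sq_nonneg (m₀ + ∑ A, m A * (t A).re)]

/-- If all imaginary parts vanish (real data, e.g. `SO(N)` or factorised planar values) the finite-`N`
reading of the block is non-negative on the nose. [folklore] -/
theorem shorPairing_re_nonneg_of_im_eq_zero (m₀ : ℝ) (m : ι → ℝ) (t : ι → ℂ) (h : ∀ A, (t A).im = 0) :
    0 ≤ shorPairing m₀ m (fun A => (t A).re) (fun A B => (t A * t B).re) := by
  rw [shorPairing_re_eq]
  simp only [h, mul_zero, Finset.sum_const_zero]
  linarith [sq_nonneg (m₀ + ∑ A, m A * (t A).re)]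

/-- Cauchy–Schwarz in the crude form used for the large-`N` limit:
`(Σ_A m_A y_A)² ≤ #ι · Σ_A m_A² y_A²`. [folklore] -/
theorem sq_sum_mul_le_card (m y : ι → ℝ) :
    (∑ A, m A * y A) ^ 2 ≤ Fintype.card ι * ∑ A, m A ^ 2 * y A ^ 2 := by
  have h := sq_sum_le_card_mul_sum_sq (s := Finset.univ) (f := fun A => m A * y A)
  simp only [Finset.card_univ, mul_pow] at h
  exact h

/-! ## The reading for a state: `W = Re E t`, `Q = Re E[t t]` -/

section Measure

variable {Ω : Type*} [MeasurableSpace Ω] (μ : Measure Ω) [IsProbabilityMeasure μ]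

/-- Bounded measurable complex observables are integrable on a probability space. [folklore] -/
theorem integrable_of_norm_le_one {f : Ω → ℂ} (hf : AEStronglyMeasurable f μ) (hb : ∀ ω, ‖f ω‖ ≤ 1) :
    Integrable f μ :=
  Integrable.of_bound hf 1 (Filter.Eventually.of_forall hb)

/-- Products of observables bounded by `1` are bounded by `1`. [folklore] -/
theorem norm_mul_le_one_of_norm_le_one {a b : ℂ} (ha : ‖a‖ ≤ 1) (hb : ‖b‖ ≤ 1) : ‖a * b‖ ≤ 1 := by
  rw [norm_mul]; exact mul_le_one₀ ha (norm_nonneg _) hb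

variable {μ}

/-- A real combination `m₀ + Σ m_A Re t_A` of bounded measurable observables is integrable, and so
is its square. [folklore] -/
theorem integrable_sq_affine_re (m₀ : ℝ) (m : ι → ℝ) {t : ι → Ω → ℂ}
    (hm : ∀ A, AEStronglyMeasurable (t A) μ) (hb : ∀ A ω, ‖t A ω‖ ≤ 1) :
    Integrable (fun ω => (m₀ + ∑ A, m A * (t A ω).re) ^ 2) μ := by
  have hmeas : AEStronglyMeasurable (fun ω => m₀ + ∑ A, m A * (t A ω).re) μ := by
    refine aestronglyMeasurable_const.add (Finset.aestronglyMeasurable_fun_sum _ fun A _ => ?_)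
    exact (Complex.continuous_re.comp_aestronglyMeasurable (hm A)).const_mul _
  refine Integrable.of_bound (hmeas.pow 2) ((|m₀| + ∑ A, |m A|) ^ 2) (Filter.Eventually.of_forall fun ω => ?_)
  rw [Real.norm_eq_abs, abs_pow, sq_abs, ← sq_abs]
  have hle : |m₀ + ∑ A, m A * (t A ω).re| ≤ |m₀| + ∑ A, |m A| := by
    have hs : |∑ A, m A * (t A ω).re| ≤ ∑ A, |m A| := by
      refine (Finset.abs_sum_le_sum_abs _ _).trans (Finset.sum_le_sum fun A _ => ?_)
      rw [abs_mul]
      exact mul_le_of_le_one_right (abs_nonneg _) ((Complex.abs_re_le_norm _).trans (hb A ω))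
    exact (abs_add_le _ _).trans (by linarith)
  exact pow_le_pow_left₀ (abs_nonneg _) hle 2

/-- The square of a real combination `Σ m_A Im t_A` of bounded measurable observables is integrable. [folklore] -/
theorem integrable_sq_sum_im (m : ι → ℝ) {t : ι → Ω → ℂ}
    (hm : ∀ A, AEStronglyMeasurable (t A) μ) (hb : ∀ A ω, ‖t A ω‖ ≤ 1) :
    Integrable (fun ω => (∑ A, m A * (t A ω).im) ^ 2) μ := by
  have hmeas : AEStronglyMeasurable (fun ω => ∑ A, m A * (t A ω).im) μ :=
    Finset.aestronglyMeasurable_fun_sum _ fun A _ =>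
      (Complex.continuous_im.comp_aestronglyMeasurable (hm A)).const_mul _
  refine Integrable.of_bound (hmeas.pow 2) ((∑ A, |m A|) ^ 2) (Filter.Eventually.of_forall fun ω => ?_)
  rw [Real.norm_eq_abs, abs_pow, sq_abs, ← sq_abs]
  have hle : |∑ A, m A * (t A ω).im| ≤ ∑ A, |m A| := by
    refine (Finset.abs_sum_le_sum_abs _ _).trans (Finset.sum_le_sum fun A _ => ?_)
    rw [abs_mul]
    exact mul_le_of_le_one_right (abs_nonneg _) ((Complex.abs_im_le_norm _).trans (hb A ω))
  exact pow_le_pow_left₀ (abs_nonneg _) hle 2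

/-- The square of the imaginary part of a bounded measurable observable is integrable. [folklore] -/
theorem integrable_sq_im {f : Ω → ℂ} (hf : AEStronglyMeasurable f μ) (hb : ∀ ω, ‖f ω‖ ≤ 1) :
    Integrable (fun ω => (f ω).im ^ 2) μ := by
  refine Integrable.of_bound ((Complex.continuous_im.comp_aestronglyMeasurable hf).pow 2) 1
    (Filter.Eventually.of_forall fun ω => ?_)
  rw [Real.norm_eq_abs, abs_pow, sq_abs]
  have h1 : |(f ω).im| ≤ 1 := (Complex.abs_im_le_norm _).trans (hb ω)
  have h2 : (f ω).im ^ 2 = |(f ω).im| ^ 2 := (sq_abs _).symm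
  rw [h2]
  nlinarith [abs_nonneg (f ω).im]

/-- **The pairing is affine, so it passes inside the expectation**: with `W_A = Re E t_A` and
`Q_{AB} = Re E[t_A t_B]`, `shorPairing m₀ m W Q = E[ shorPairing m₀ m (Re t) (Re(t t)) ]`. [folklore] -/
theorem shorPairing_integral_eq_integral (m₀ : ℝ) (m : ι → ℝ) {t : ι → Ω → ℂ}
    (hm : ∀ A, AEStronglyMeasurable (t A) μ) (hb : ∀ A ω, ‖t A ω‖ ≤ 1) :
    shorPairing m₀ m (fun A => (∫ ω, t A ω ∂μ).re) (fun A B => (∫ ω, t A ω * t B ω ∂μ).re) =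
      ∫ ω, shorPairing m₀ m (fun A => (t A ω).re) (fun A B => (t A ω * t B ω).re) ∂μ := by
  have hiA : ∀ A, Integrable (t A) μ := fun A => integrable_of_norm_le_one μ (hm A) (hb A)
  have hiAB : ∀ A B, Integrable (fun ω => t A ω * t B ω) μ := fun A B =>
    integrable_of_norm_le_one μ ((hm A).mul (hm B)) fun ω => norm_mul_le_one_of_norm_le_one (hb A ω) (hb B ω)
  have hre : ∀ A, (∫ ω, t A ω ∂μ).re = ∫ ω, (t A ω).re ∂μ := fun A => by
    have h := integral_re (hiA A); simp only [RCLike.re_to_complex] at h; exact h.symm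
  have hre2 : ∀ A B, (∫ ω, t A ω * t B ω ∂μ).re = ∫ ω, (t A ω * t B ω).re ∂μ := fun A B => by
    have h := integral_re (hiAB A B); simp only [RCLike.re_to_complex] at h; exact h.symm
  have hiRe : ∀ A, Integrable (fun ω => (t A ω).re) μ := fun A => (hiA A).re
  have hiRe2 : ∀ A B, Integrable (fun ω => (t A ω * t B ω).re) μ := fun A B => (hiAB A B).re
  -- right-hand side, term by term
  have hW : Integrable (fun ω => ∑ A, (2 * m₀ * m A) * (t A ω).re) μ :=
    integrable_finsetSum _ fun A _ => (hiRe A).const_mul _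
  have hQ : Integrable (fun ω => ∑ A, ∑ B, (m A * m B) * (t A ω * t B ω).re) μ :=
    integrable_finsetSum _ fun A _ => integrable_finsetSum _ fun B _ => (hiRe2 A B).const_mul _
  have hCW : Integrable (fun ω => m₀ ^ 2 + ∑ A, (2 * m₀ * m A) * (t A ω).re) μ := (integrable_const _).add hW
  have e1 : ∫ ω, (m₀ ^ 2 + ∑ A, (2 * m₀ * m A) * (t A ω).re + ∑ A, ∑ B, (m A * m B) * (t A ω * t B ω).re) ∂μ =
      (∫ ω, (m₀ ^ 2 + ∑ A, (2 * m₀ * m A) * (t A ω).re) ∂μ) + ∫ ω, ∑ A, ∑ B, (m A * m B) * (t A ω * t B ω).re ∂μ :=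
    integral_add hCW hQ
  have e2 : ∫ ω, (m₀ ^ 2 + ∑ A, (2 * m₀ * m A) * (t A ω).re) ∂μ = m₀ ^ 2 + ∫ ω, ∑ A, (2 * m₀ * m A) * (t A ω).re ∂μ := by
    rw [integral_add (integrable_const _) hW, integral_const]
    simp
  have e3 : ∫ ω, ∑ A, (2 * m₀ * m A) * (t A ω).re ∂μ = ∑ A, (2 * m₀ * m A) * (∫ ω, t A ω ∂μ).re := by
    rw [integral_finsetSum _ fun A _ => (hiRe A).const_mul _]
    exact Finset.sum_congr rfl fun A _ => by rw [integral_const_mul, hre]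
  have e4 : ∫ ω, ∑ A, ∑ B, (m A * m B) * (t A ω * t B ω).re ∂μ = ∑ A, ∑ B, (m A * m B) * (∫ ω, t A ω * t B ω ∂μ).re := by
    rw [integral_finsetSum _ fun A _ => integrable_finsetSum _ fun B _ => (hiRe2 A B).const_mul _]
    refine Finset.sum_congr rfl fun A _ => ?_
    rw [integral_finsetSum _ fun B _ => (hiRe2 A B).const_mul _]
    exact Finset.sum_congr rfl fun B _ => by rw [integral_const_mul, hre2]
  simp_rw [shorPairing_eq_sum]
  rw [e1, e2, e3, e4]

/-- **THE RELAXATION BLOCK AT FINITE `N` (states)**: for complex observables `t_A` bounded by `1`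
on a probability space, with `W_A = Re E t_A` and `Q_{AB} = Re E[t_A t_B]` (the pair expectation),
`⟨m mᵀ, [[1, Wᵀ], [W, Q]]⟩ = E(m₀ + Σ_A m_A Re t_A)² − E(Σ_A m_A Im t_A)²`. [folklore] -/
theorem shorPairing_integral_eq (m₀ : ℝ) (m : ι → ℝ) {t : ι → Ω → ℂ}
    (hm : ∀ A, AEStronglyMeasurable (t A) μ) (hb : ∀ A ω, ‖t A ω‖ ≤ 1) :
    shorPairing m₀ m (fun A => (∫ ω, t A ω ∂μ).re) (fun A B => (∫ ω, t A ω * t B ω ∂μ).re) =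
      (∫ ω, (m₀ + ∑ A, m A * (t A ω).re) ^ 2 ∂μ) - ∫ ω, (∑ A, m A * (t A ω).im) ^ 2 ∂μ := by
  rw [shorPairing_integral_eq_integral m₀ m hm hb]
  simp_rw [shorPairing_re_eq]
  exact integral_sub (integrable_sq_affine_re m₀ m hm hb) (integrable_sq_sum_im m hm hb)

/-- **Hence the block is violated by at most the second moment of the imaginary parts**:
`⟨m mᵀ, [[1, Wᵀ], [W, Q]]⟩ ≥ −E(Σ_A m_A Im t_A)²`. [folklore] -/
theorem shorPairing_integral_ge (m₀ : ℝ) (m : ι → ℝ) {t : ι → Ω → ℂ}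
    (hm : ∀ A, AEStronglyMeasurable (t A) μ) (hb : ∀ A ω, ‖t A ω‖ ≤ 1) :
    -(∫ ω, (∑ A, m A * (t A ω).im) ^ 2 ∂μ) ≤
      shorPairing m₀ m (fun A => (∫ ω, t A ω ∂μ).re) (fun A B => (∫ ω, t A ω * t B ω ∂μ).re) := by
  rw [shorPairing_integral_eq m₀ m hm hb]
  linarith [integral_nonneg (μ := μ) (f := fun ω => (m₀ + ∑ A, m A * (t A ω).re) ^ 2) fun ω => sq_nonneg _]

/-- The defect in terms of single-loop second moments:
`E(Σ_A m_A Im t_A)² ≤ #ι · Σ_A m_A² E(Im t_A)²`. [folklore] -/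
theorem integral_sq_sum_im_le_card (m : ι → ℝ) {t : ι → Ω → ℂ}
    (hm : ∀ A, AEStronglyMeasurable (t A) μ) (hb : ∀ A ω, ‖t A ω‖ ≤ 1) :
    ∫ ω, (∑ A, m A * (t A ω).im) ^ 2 ∂μ ≤
      Fintype.card ι * ∑ A, m A ^ 2 * ∫ ω, (t A ω).im ^ 2 ∂μ := by
  have hi : ∀ A, Integrable (fun ω => m A ^ 2 * (t A ω).im ^ 2) μ := fun A =>
    (integrable_sq_im (hm A) (hb A)).const_mul _
  calc ∫ ω, (∑ A, m A * (t A ω).im) ^ 2 ∂μ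
      ≤ ∫ ω, Fintype.card ι * ∑ A, m A ^ 2 * (t A ω).im ^ 2 ∂μ :=
        integral_mono (integrable_sq_sum_im m hm hb) ((integrable_finsetSum _ fun A _ => hi A).const_mul _)
          fun ω => sq_sum_mul_le_card m fun A => (t A ω).im
    _ = Fintype.card ι * ∑ A, m A ^ 2 * ∫ ω, (t A ω).im ^ 2 ∂μ := by
        rw [integral_const_mul, integral_finsetSum _ fun A _ => hi A]
        simp only [integral_const_mul]

/-- **The crude form**: `⟨m mᵀ, [[1, Wᵀ], [W, Q]]⟩ ≥ −#ι · Σ_A m_A² E(Im t_A)²` — the relaxation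
constraint of the planar SDP fails at finite `N` by at most a multiple of the largest second moment
of the imaginary part of a loop variable entering it. [folklore] -/
theorem shorPairing_integral_ge_card (m₀ : ℝ) (m : ι → ℝ) {t : ι → Ω → ℂ}
    (hm : ∀ A, AEStronglyMeasurable (t A) μ) (hb : ∀ A ω, ‖t A ω‖ ≤ 1) :
    -(Fintype.card ι * ∑ A, m A ^ 2 * ∫ ω, (t A ω).im ^ 2 ∂μ) ≤
      shorPairing m₀ m (fun A => (∫ ω, t A ω ∂μ).re) (fun A B => (∫ ω, t A ω * t B ω ∂μ).re) :=
  (neg_le_neg (integral_sq_sum_im_le_card m hm hb)).trans (shorPairing_integral_ge m₀ m hm hb)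

/-- **Real loop variables satisfy the relaxation at every `N`**: if every `t_A` is real-valued
(e.g. `SO(N)`, or `U(1)`-free real characters), the state's data `(Re E t, Re E[t t])` is feasible
for Kazakov–Zheng's relaxation — it is then the covariance form `Q − W Wᵀ ⪰ 0`. [folklore] -/
theorem isRelaxationFeasible_integral_of_im_eq_zero {t : ι → Ω → ℂ}
    (hm : ∀ A, AEStronglyMeasurable (t A) μ) (hb : ∀ A ω, ‖t A ω‖ ≤ 1) (hreal : ∀ A ω, (t A ω).im = 0) :
    IsRelaxationFeasible (fun A => (∫ ω, t A ω ∂μ).re) (fun A B => (∫ ω, t A ω * t B ω ∂μ).re) := by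
  intro m₀ m
  refine le_trans ?_ (shorPairing_integral_ge m₀ m hm hb)
  simp only [hreal, mul_zero, Finset.sum_const_zero]
  simp

end Measure

/-! ## The reading for a linear functional non-negative on squares (the word-truncated bootstrap) -/

section Functional

variable {R : Type*} [CommRing R] [Algebra ℝ R]

/-- **The relaxation block for a bootstrap functional**: for a linear `φ` on a commutative
`ℝ`-algebra with `φ 1 = 1`, "real parts" `a_A` and "imaginary parts" `b_A` of the loop variables,
`W_A = φ a_A` and `Q_{AB} = φ (a_A a_B − b_A b_B)` (`= φ Re(t_A t_B)`):
`shorPairing m₀ m W Q = φ((m₀ + Σ m_A a_A)²) − φ((Σ m_A b_A)²)`. [folklore] -/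
theorem shorPairing_apply_eq (φ : R →ₗ[ℝ] ℝ) (h1 : φ 1 = 1) (m₀ : ℝ) (m : ι → ℝ) (a b : ι → R) :
    shorPairing m₀ m (fun A => φ (a A)) (fun A B => φ (a A * a B - b A * b B)) =
      φ ((algebraMap ℝ R m₀ + ∑ A, m A • a A) ^ 2) - φ ((∑ A, m A • b A) ^ 2) := by
  have hsqA : (algebraMap ℝ R m₀ + ∑ A, m A • a A) ^ 2 =
      algebraMap ℝ R (m₀ ^ 2) + ∑ A, (2 * m₀ * m A) • a A + ∑ A, ∑ B, (m A * m B) • (a A * a B) := by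
    rw [sq, add_mul, mul_add, mul_add, Finset.sum_mul_sum]
    have e1 : algebraMap ℝ R m₀ * algebraMap ℝ R m₀ = algebraMap ℝ R (m₀ ^ 2) := by rw [← map_mul, sq]
    have e2 : algebraMap ℝ R m₀ * ∑ A, m A • a A = ∑ A, (m₀ * m A) • a A := by
      rw [Finset.mul_sum]
      exact Finset.sum_congr rfl fun A _ => by rw [Algebra.algebraMap_eq_smul_one, smul_mul_smul_comm, one_mul]
    have e3 : (∑ A, m A • a A) * algebraMap ℝ R m₀ = ∑ A, (m₀ * m A) • a A := by
      rw [mul_comm]; exact e2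
    have e4 : ∑ A, ∑ B, m A • a A * m B • a B = ∑ A, ∑ B, (m A * m B) • (a A * a B) :=
      Finset.sum_congr rfl fun A _ => Finset.sum_congr rfl fun B _ => by rw [smul_mul_smul_comm]
    rw [e1, e2, e3, e4, ← add_assoc, add_assoc (algebraMap ℝ R (m₀ ^ 2)), ← Finset.sum_add_distrib]
    congr 2
    exact Finset.sum_congr rfl fun A _ => by rw [← add_smul]; ring_nf
  have hsqB : (∑ A, m A • b A) ^ 2 = ∑ A, ∑ B, (m A * m B) • (b A * b B) := by
    rw [sq, Finset.sum_mul_sum]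
    exact Finset.sum_congr rfl fun A _ => Finset.sum_congr rfl fun B _ => by rw [smul_mul_smul_comm]
  rw [hsqA, hsqB, shorPairing_eq_sum]
  simp only [map_add, map_sum, map_smul, smul_eq_mul, Algebra.algebraMap_eq_smul_one, h1, mul_one, map_sub,
    mul_sub, Finset.sum_sub_distrib]
  ring

/-- **Hence for every linear functional non-negative on squares** (every feasible point of the
word-truncated bootstrap at a level containing the `a_A`): the relaxation block of its data is
violated by at most `φ((Σ m_A b_A)²)`, the functional's "second moment of the imaginary parts".
[folklore] -/
theorem shorPairing_apply_ge (φ : R →ₗ[ℝ] ℝ) (h1 : φ 1 = 1) (m₀ : ℝ) (m : ι → ℝ) (a b : ι → R)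
    (hsq : 0 ≤ φ ((algebraMap ℝ R m₀ + ∑ A, m A • a A) ^ 2)) :
    -φ ((∑ A, m A • b A) ^ 2) ≤ shorPairing m₀ m (fun A => φ (a A)) (fun A B => φ (a A * a B - b A * b B)) := by
  rw [shorPairing_apply_eq φ h1]
  linarith

end Functional

end Summit.QuantumFields.GaugeBoot

end
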